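import Summits.CriticalPhenomena.PercolationContinuityZ3.Theorems.PercNearOneGluingNoHeavyConstsClusterSquareMinorBridge
import HarnessLib

/-!
# Partial 2-trees have no `K₄` minor (graph-theoretic part of the series-parallel certificate)

builds on p205010 (kernel theorem, internal audit signed; external expert review pending)

PAPER-2 track "percolation constants", part (ii), seat `prim-consts-1`, gen 23 (lane index
`run/shared/lean/prim/consts/CONSTANTS.md`, row A19; memo `FROM-prim-consts-1-g23-SERIES-PARALLEL.md` §2(ii)).
Support file for the crux `NoHeavyLowerTail` (stmt-CriticalPhenomena-4575; `--supports`).  Theorems only; no definitions, no sorries.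

`…ConstsClusterSquareSeriesParallel.lean` proves TS for every weight vector whose positive-pair graph has no `K₄` minor, the minor
being stated in branch-set form (`∀ B₀ B₁ B₂ B₃, … → False`) — a hypothesis a user must discharge by a graph-theoretic argument.
THIS FILE supplies the standard CERTIFICATE: a PARTIAL 2-TREE structure.  Data: two parent maps `p₁ p₂ : Fin n → Fin n`; the
graph `H` is a partial 2-tree along `(p₁, p₂)` if every edge `{u, w}` with `u < w` has `u ∈ {p₁ w, p₂ w}` ("each vertex is joined
downwards only to its two parents") and the parents themselves are compatible: whenever `p₁ w, p₂ w < w` are distinct, the smaller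
is a parent of the larger (so that the edge `{p₁ w, p₂ w}` is again of the allowed form — the 2-tree closure).  Every 2-tree in an
elimination order, hence every series-parallel graph suitably labelled, has this form (Duffin 1965; Wald–Colbourn 1983).
* `Consts.Minor.reroute` — walk surgery: inside a vertex set, a walk avoiding a vertex `v` exists in the graph with `v`'s lower
  neighbours made adjacent;
* **`Consts.noK4Minor_of_partialTwoTree`** — such an `H` has no `K₄` minor (branch-set form).  Proof: induction on the largest model
  vertex `v`; it has at most the two neighbours `p₁ v, p₂ v` inside the model, so it is not a whole branch set, and deleting it
  from its branch set while adding the edge `p₁ v ~ p₂ v` (allowed by the closure condition) leaves a `K₄` model on smaller vertices;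
* the probabilistic corollary `Consts.tripleSplit_partialTwoTree` (TS under purely syntactic hypotheses) is in
  `…ConstsClusterSquareTwoTreeTS.lean` (it needs `…SeriesParallel.lean`).
References: R. J. Duffin, J. Math. Anal. Appl. 10 (1965) 303–318; J. A. Wald, C. J. Colbourn, Networks 13 (1983) 159–167
(partial 2-trees = series-parallel = no `K₄` minor); R. Diestel, Graph Theory (5th ed.), §1.7, §12.3.
-/

namespace Summit.CriticalPhenomena.PercolationContinuityZ3.Theorems

namespace Consts

namespace Minor

variable {V : Type*}

/-- A set inducing a connected subgraph contains an `H`-walk between any two of its vertices (local copy of the lemma in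
`…W4MinorConverse.lean`, to keep this file's imports minimal). [folklore] -/
private theorem exists_walk_of_induce_connected' {H : SimpleGraph V} {S : Set V} (h : (H.induce S).Connected) {u v : V}
    (hu : u ∈ S) (hv : v ∈ S) : ∃ W : H.Walk u v, ∀ x ∈ W.support, x ∈ S := by
  obtain ⟨p⟩ := h.preconnected ⟨u, hu⟩ ⟨v, hv⟩
  suffices key : ∀ (s t : S) (q : (H.induce S).Walk s t), ∃ W : H.Walk s.1 t.1, ∀ x ∈ W.support, x ∈ S from key _ _ p
  intro s t q
  induction q with
  | nil =>
    rename_i s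
    refine ⟨SimpleGraph.Walk.nil, fun x hx => ?_⟩
    rw [SimpleGraph.Walk.support_nil, List.mem_singleton] at hx
    exact hx ▸ s.2
  | cons hst q' ih =>
    rename_i s t r
    obtain ⟨W, hW⟩ := ih
    refine ⟨SimpleGraph.Walk.cons ((SimpleGraph.Embedding.induce S).map_adj_iff.mpr hst) W, fun x hx => ?_⟩
    rw [SimpleGraph.Walk.support_cons, List.mem_cons] at hx
    rcases hx with rfl | hx
    · exact s.2
    · exact hW x hx

/-- **Rerouting around a vertex.**  Let `H ≤ H'` and suppose every two distinct `H`-neighbours of `v` satisfying a predicate `L` are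
`H'`-adjacent.  Then every `H`-walk inside a set `B` between vertices `≠ v`, all of whose visits to `v` come from and go to
`L`-neighbours, can be replaced by an `H'`-walk inside `B ∖ {v}`.  (Here: `L` = "lower than `v` and in `B`".) [folklore] -/
theorem reroute {H H' : SimpleGraph V} (hle : H ≤ H') (v : V) (B : Set V) (L : V → Prop)
    (hL : ∀ x, x ∈ B → x ≠ v → L x)
    (hnb : ∀ x y, L x → L y → H.Adj v x → H.Adj v y → x ≠ y → H'.Adj x y) :
    ∀ (k : ℕ) {x y : V} (W : H.Walk x y), W.length ≤ k → x ≠ v → y ≠ v → (∀ t ∈ W.support, t ∈ B) →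
      ∃ W' : H'.Walk x y, ∀ t ∈ W'.support, t ∈ B ∧ t ≠ v := by
  intro k
  induction k with
  | zero =>
    intro x y W hlen hx _ hB
    obtain rfl := SimpleGraph.Walk.eq_of_length_eq_zero (Nat.le_zero.mp hlen)
    refine ⟨SimpleGraph.Walk.nil, fun t ht => ?_⟩
    rw [SimpleGraph.Walk.support_nil, List.mem_singleton] at ht
    exact ht ▸ ⟨hB x W.start_mem_support, hx⟩
  | succ k ih =>
    intro x y W hlen hx hy hB
    cases W with
    | nil =>
      refine ⟨SimpleGraph.Walk.nil, fun t ht => ?_⟩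
      rw [SimpleGraph.Walk.support_nil, List.mem_singleton] at ht
      exact ht ▸ ⟨hB x (SimpleGraph.Walk.nil : H.Walk x x).start_mem_support, hx⟩
    | cons hxx₁ W₁ =>
      rename_i x₁
      have hxB : x ∈ B := hB x (SimpleGraph.Walk.cons hxx₁ W₁).start_mem_support
      have hB₁ : ∀ t ∈ W₁.support, t ∈ B := fun t ht => hB t (List.mem_cons_of_mem _ ht)
      have hlen₁ : W₁.length ≤ k := by
        rw [SimpleGraph.Walk.length_cons] at hlen; omega
      by_cases hx₁ : x₁ = v
      · subst hx₁
        cases W₁ with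
        | nil => exact absurd rfl hy
        | cons hvx₂ W₂ =>
          rename_i x₂
          have hB₂ : ∀ t ∈ W₂.support, t ∈ B := fun t ht => hB₁ t (List.mem_cons_of_mem _ ht)
          have hlen₂ : W₂.length ≤ k := by
            rw [SimpleGraph.Walk.length_cons] at hlen₁; omega
          have hx₂v : x₂ ≠ x₁ := hvx₂.ne.symm
          by_cases hxx₂ : x = x₂
          · subst hxx₂
            exact ih W₂ hlen₂ hx hy hB₂
          · obtain ⟨W', hW'⟩ := ih W₂ hlen₂ hx₂v hy hB₂
            have hx₂B : x₂ ∈ B := hB₂ x₂ W₂.start_mem_support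
            refine ⟨SimpleGraph.Walk.cons (hnb x x₂ (hL x hxB hx) (hL x₂ hx₂B hx₂v) hxx₁.symm hvx₂ hxx₂) W',
              fun t ht => ?_⟩
            rw [SimpleGraph.Walk.support_cons, List.mem_cons] at ht
            rcases ht with rfl | ht
            · exact ⟨hxB, hx⟩
            · exact hW' t ht
      · obtain ⟨W', hW'⟩ := ih W₁ hlen₁ hx₁ hy hB₁
        refine ⟨SimpleGraph.Walk.cons (hle hxx₁) W', fun t ht => ?_⟩
        rw [SimpleGraph.Walk.support_cons, List.mem_cons] at ht
        rcases ht with rfl | ht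
        · exact ⟨hxB, hx⟩
        · exact hW' t ht

/-- Monotonicity of induced connectivity in the graph. [folklore] -/
theorem induce_connected_mono {H H' : SimpleGraph V} (hle : H ≤ H') {S : Set V} (h : (H.induce S).Connected) :
    (H'.induce S).Connected :=
  h.mono fun _ _ hab => hle hab

end Minor

open Minor

section TwoTree

variable {n : ℕ} (p₁ p₂ : Fin n → Fin n)

/-- **Elimination step.**  In a partial 2-tree along `(p₁, p₂)`, a `K₄` model whose largest vertex `v` lies in `B₀` yields a `K₄`
model on vertices `< v` in the partial 2-tree `H ⊔ {p₁ v ~ p₂ v}` (lower neighbours of `v` made adjacent), with `B₀` replaced by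
`B₀ ∖ {v}`. [cite: Duffin1965, Thm. 1; Diestel2017, §1.7] -/
theorem Minor.twoTree_step
    (hT : ∀ w : Fin n, p₁ w < w → p₂ w < w → p₁ w ≠ p₂ w →
      (p₁ w < p₂ w ∧ (p₁ w = p₁ (p₂ w) ∨ p₁ w = p₂ (p₂ w))) ∨ (p₂ w < p₁ w ∧ (p₂ w = p₁ (p₁ w) ∨ p₂ w = p₂ (p₁ w))))
    (H : SimpleGraph (Fin n)) (hH : ∀ u w, H.Adj u w → u < w → u = p₁ w ∨ u = p₂ w) (v : Fin n)
    {B₀ B₁ B₂ B₃ : Set (Fin n)} (hv : v ∈ B₀)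
    (h0 : ∀ x ∈ B₀, x ≤ v) (h1 : ∀ x ∈ B₁, x ≤ v) (h2 : ∀ x ∈ B₂, x ≤ v) (h3 : ∀ x ∈ B₃, x ≤ v)
    (c0 : (H.induce B₀).Connected) (c1 : (H.induce B₁).Connected) (c2 : (H.induce B₂).Connected)
    (c3 : (H.induce B₃).Connected)
    (d01 : Disjoint B₀ B₁) (d02 : Disjoint B₀ B₂) (d03 : Disjoint B₀ B₃) (d12 : Disjoint B₁ B₂) (d13 : Disjoint B₁ B₃)
    (d23 : Disjoint B₂ B₃)
    (a01 : ∃ u ∈ B₀, ∃ x ∈ B₁, H.Adj u x) (a02 : ∃ u ∈ B₀, ∃ x ∈ B₂, H.Adj u x) (a03 : ∃ u ∈ B₀, ∃ x ∈ B₃, H.Adj u x)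
    (a12 : ∃ u ∈ B₁, ∃ x ∈ B₂, H.Adj u x) (a13 : ∃ u ∈ B₁, ∃ x ∈ B₃, H.Adj u x) (a23 : ∃ u ∈ B₂, ∃ x ∈ B₃, H.Adj u x) :
    ∃ (H' : SimpleGraph (Fin n)) (B₀' : Set (Fin n)),
      (∀ u w, H'.Adj u w → u < w → u = p₁ w ∨ u = p₂ w) ∧
      (∀ x ∈ B₀', x < v) ∧ (∀ x ∈ B₁, x < v) ∧ (∀ x ∈ B₂, x < v) ∧ (∀ x ∈ B₃, x < v) ∧
      (H'.induce B₀').Connected ∧ (H'.induce B₁).Connected ∧ (H'.induce B₂).Connected ∧ (H'.induce B₃).Connected ∧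
      Disjoint B₀' B₁ ∧ Disjoint B₀' B₂ ∧ Disjoint B₀' B₃ ∧ Disjoint B₁ B₂ ∧ Disjoint B₁ B₃ ∧ Disjoint B₂ B₃ ∧
      (∃ u ∈ B₀', ∃ x ∈ B₁, H'.Adj u x) ∧ (∃ u ∈ B₀', ∃ x ∈ B₂, H'.Adj u x) ∧ (∃ u ∈ B₀', ∃ x ∈ B₃, H'.Adj u x) ∧
      (∃ u ∈ B₁, ∃ x ∈ B₂, H'.Adj u x) ∧ (∃ u ∈ B₁, ∃ x ∈ B₃, H'.Adj u x) ∧ (∃ u ∈ B₂, ∃ x ∈ B₃, H'.Adj u x) := by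
  have dis := fun {S T : Set (Fin n)} (h : Disjoint S T) {x : Fin n} (hs : x ∈ S) (ht : x ∈ T) => Set.disjoint_left.mp h hs ht
  -- strict bounds off `B₀`, and on `B₀ \ {v}`
  have h1' : ∀ x ∈ B₁, x < v := fun x hx => lt_of_le_of_ne (h1 x hx) fun h => dis d01 hv (h ▸ hx)
  have h2' : ∀ x ∈ B₂, x < v := fun x hx => lt_of_le_of_ne (h2 x hx) fun h => dis d02 hv (h ▸ hx)
  have h3' : ∀ x ∈ B₃, x < v := fun x hx => lt_of_le_of_ne (h3 x hx) fun h => dis d03 hv (h ▸ hx)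
  -- lower neighbours of `v` are parents
  have hpar : ∀ x, H.Adj v x → x < v → x = p₁ v ∨ x = p₂ v := fun x hx hxv => hH x v hx.symm hxv
  -- the augmented graph
  let E : SimpleGraph (Fin n) := SimpleGraph.fromRel fun x y => H.Adj v x ∧ H.Adj v y ∧ x < v ∧ y < v
  let H' : SimpleGraph (Fin n) := H ⊔ E
  have hle : H ≤ H' := le_sup_left
  have hE : ∀ x y, H.Adj v x → H.Adj v y → x < v → y < v → x ≠ y → H'.Adj x y := fun x y hx hy hxv hyv hne =>
    (SimpleGraph.sup_adj _ _ _ _).mpr (Or.inr ((SimpleGraph.fromRel_adj _ _ _).mpr ⟨hne, Or.inl ⟨hx, hy, hxv, hyv⟩⟩))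
  have hH'cases : ∀ x y, H'.Adj x y → H.Adj x y ∨ (H.Adj v x ∧ H.Adj v y ∧ x < v ∧ y < v) := by
    intro x y h
    rcases (SimpleGraph.sup_adj _ _ _ _).mp h with h | h
    · exact Or.inl h
    · rcases (SimpleGraph.fromRel_adj _ _ _).mp h with ⟨_, h | h⟩
      · exact Or.inr h
      · exact Or.inr ⟨h.2.1, h.1, h.2.2.2, h.2.2.1⟩
  -- the parent condition for `H'`
  have hH' : ∀ u w, H'.Adj u w → u < w → u = p₁ w ∨ u = p₂ w := by
    intro u w huw hlt
    rcases hH'cases u w huw with h | ⟨hvu, hvw, huv, hwv⟩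
    · exact hH u w h hlt
    · have hu := hpar u hvu huv
      have hw := hpar w hvw hwv
      have hne : u ≠ w := hlt.ne
      rcases hu with rfl | rfl <;> rcases hw with hw | hw
      · exact absurd hw.symm hne
      · rw [hw] at hlt ⊢
        rcases hT v huv (hw ▸ hwv) (hw ▸ hne) with ⟨_, h⟩ | ⟨h, _⟩
        · exact h
        · exact absurd (lt_trans hlt h) (lt_irrefl _)
      · rw [hw] at hlt ⊢
        rcases hT v (hw ▸ hwv) huv (hw ▸ hne).symm with ⟨h, _⟩ | ⟨_, h⟩
        · exact absurd (lt_trans hlt h) (lt_irrefl _)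
        · exact h
      · exact absurd hw.symm hne
  -- `v` has a neighbour inside `B₀`: `B₀ ≠ {v}` because `v` has at most two lower neighbours
  obtain ⟨u₁, hu₁, x₁, hx₁, e₁⟩ := a01
  obtain ⟨u₂, hu₂, x₂, hx₂, e₂⟩ := a02
  obtain ⟨u₃, hu₃, x₃, hx₃, e₃⟩ := a03
  have hB₀two : ∃ u ∈ B₀, u ≠ v := by
    by_contra hcon
    push Not at hcon
    have e₁' : H.Adj v x₁ := (hcon u₁ hu₁) ▸ e₁
    have e₂' : H.Adj v x₂ := (hcon u₂ hu₂) ▸ e₂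
    have e₃' : H.Adj v x₃ := (hcon u₃ hu₃) ▸ e₃
    have q₁ := hpar x₁ e₁' (h1' x₁ hx₁)
    have q₂ := hpar x₂ e₂' (h2' x₂ hx₂)
    have q₃ := hpar x₃ e₃' (h3' x₃ hx₃)
    have n12 : x₁ ≠ x₂ := fun h => dis d12 hx₁ (h ▸ hx₂)
    have n13 : x₁ ≠ x₃ := fun h => dis d13 hx₁ (h ▸ hx₃)
    have n23 : x₂ ≠ x₃ := fun h => dis d23 hx₂ (h ▸ hx₃)
    rcases q₁ with q₁ | q₁ <;> rcases q₂ with q₂ | q₂ <;> rcases q₃ with q₃ | q₃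
    · exact n12 (q₁.trans q₂.symm)
    · exact n12 (q₁.trans q₂.symm)
    · exact n13 (q₁.trans q₃.symm)
    · exact n23 (q₂.trans q₃.symm)
    · exact n23 (q₂.trans q₃.symm)
    · exact n13 (q₁.trans q₃.symm)
    · exact n12 (q₁.trans q₂.symm)
    · exact n12 (q₁.trans q₂.symm)
  obtain ⟨u₀, hu₀, hu₀v⟩ := hB₀two
  -- a `B₀`-neighbour of `v`
  obtain ⟨Wv, hWv⟩ := exists_walk_of_induce_connected' c0 hv hu₀
  obtain ⟨nv, hvnv, Wv', hWv'⟩ := exists_cons Wv hu₀v.symm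
  have hnvB : nv ∈ B₀ := hWv nv (by rw [hWv']; exact List.mem_cons_of_mem _ Wv'.start_mem_support)
  have hnvv : nv ≠ v := hvnv.ne.symm
  have hnvlt : nv < v := lt_of_le_of_ne (h0 nv hnvB) hnvv
  -- the new branch set
  set B₀' : Set (Fin n) := B₀ \ {v} with hB₀'def
  have hB₀'sub : ∀ x ∈ B₀', x ∈ B₀ := fun x hx => hx.1
  have hB₀'lt : ∀ x ∈ B₀', x < v := fun x hx => lt_of_le_of_ne (h0 x hx.1) fun h => hx.2 h
  -- connectivity of `B₀'` in `H'` by rerouting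
  have hcB₀' : (H'.induce B₀').Connected := by
    refine SimpleGraph.induce_connected_of_patches nv ⟨hnvB, hnvv⟩ fun {x} hx => ?_
    obtain ⟨W, hW⟩ := exists_walk_of_induce_connected' c0 hnvB hx.1
    obtain ⟨W', hW'⟩ := reroute hle v B₀ (fun t => t < v ∧ t ∈ B₀) (fun t ht htv => ⟨lt_of_le_of_ne (h0 t ht) htv, ht⟩)
      (fun x y hx hy ex ey hne => hE x y ex ey hx.1 hy.1 hne) W.length W le_rfl hnvv (fun h => hx.2 h) hW
    exact ⟨{t | t ∈ W'.support}, fun t ht => ⟨(hW' t ht).1, (hW' t ht).2⟩, W'.start_mem_support, W'.end_mem_support,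
      (W'.connected_induce_support).preconnected _ _⟩
  -- adjacency from `B₀'`: an edge from `v` is replaced by one from the `B₀`-neighbour `nv` of `v`
  have hadj : ∀ (Bi : Set (Fin n)), Disjoint B₀ Bi → (∀ x ∈ Bi, x < v) → ∀ u ∈ B₀, ∀ x ∈ Bi, H.Adj u x →
      ∃ u' ∈ B₀', ∃ x' ∈ Bi, H'.Adj u' x' := by
    intro Bi hdis hlt u hu x hx hux
    by_cases huv : u = v
    · subst huv
      refine ⟨nv, ⟨hnvB, hnvv⟩, x, hx, hE nv x hvnv hux hnvlt (hlt x hx) fun h => dis hdis hnvB (h ▸ hx)⟩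
    · exact ⟨u, ⟨hu, huv⟩, x, hx, hle hux⟩
  obtain ⟨u₄, hu₄, x₄, hx₄, e₄⟩ := a12
  obtain ⟨u₅, hu₅, x₅, hx₅, e₅⟩ := a13
  obtain ⟨u₆, hu₆, x₆, hx₆, e₆⟩ := a23
  exact ⟨H', B₀', hH', hB₀'lt, h1', h2', h3', hcB₀', induce_connected_mono hle c1, induce_connected_mono hle c2,
    induce_connected_mono hle c3,
    Set.disjoint_left.mpr fun x hx hx' => dis d01 hx.1 hx', Set.disjoint_left.mpr fun x hx hx' => dis d02 hx.1 hx',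
    Set.disjoint_left.mpr fun x hx hx' => dis d03 hx.1 hx', d12, d13, d23,
    hadj B₁ d01 h1' u₁ hu₁ x₁ hx₁ e₁, hadj B₂ d02 h2' u₂ hu₂ x₂ hx₂ e₂, hadj B₃ d03 h3' u₃ hu₃ x₃ hx₃ e₃,
    ⟨u₄, hu₄, x₄, hx₄, hle e₄⟩, ⟨u₅, hu₅, x₅, hx₅, hle e₅⟩, ⟨u₆, hu₆, x₆, hx₆, hle e₆⟩⟩

/-- **A partial 2-tree has no `K₄` minor** (branch-set form).  If every edge `{u < w}` of `H` has `u ∈ {p₁ w, p₂ w}` and distinct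
parents `p₁ w, p₂ w < w` always have the smaller one a parent of the larger, then there are no four pairwise disjoint vertex sets,
each inducing a connected subgraph of `H`, pairwise joined by `H`-edges.
[cite: Duffin1965, Thm. 1 (series-parallel ⟺ no `K₄`); Diestel2017, §1.7, §12.3] -/
theorem noK4Minor_of_partialTwoTree
    (hT : ∀ w : Fin n, p₁ w < w → p₂ w < w → p₁ w ≠ p₂ w →
      (p₁ w < p₂ w ∧ (p₁ w = p₁ (p₂ w) ∨ p₁ w = p₂ (p₂ w))) ∨ (p₂ w < p₁ w ∧ (p₂ w = p₁ (p₁ w) ∨ p₂ w = p₂ (p₁ w))))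
    (H : SimpleGraph (Fin n)) (hH : ∀ u w, H.Adj u w → u < w → u = p₁ w ∨ u = p₂ w) :
    ∀ B₀ B₁ B₂ B₃ : Set (Fin n),
      (H.induce B₀).Connected → (H.induce B₁).Connected → (H.induce B₂).Connected → (H.induce B₃).Connected →
      Disjoint B₀ B₁ → Disjoint B₀ B₂ → Disjoint B₀ B₃ → Disjoint B₁ B₂ → Disjoint B₁ B₃ → Disjoint B₂ B₃ →
      (∃ u ∈ B₀, ∃ v ∈ B₁, H.Adj u v) → (∃ u ∈ B₀, ∃ v ∈ B₂, H.Adj u v) → (∃ u ∈ B₀, ∃ v ∈ B₃, H.Adj u v) →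
      (∃ u ∈ B₁, ∃ v ∈ B₂, H.Adj u v) → (∃ u ∈ B₁, ∃ v ∈ B₃, H.Adj u v) → (∃ u ∈ B₂, ∃ v ∈ B₃, H.Adj u v) → False := by
  -- induction on a bound `m` for the values of the model's vertices, over all partial 2-trees along `(p₁, p₂)`
  suffices key : ∀ (m : ℕ) (G : SimpleGraph (Fin n)), (∀ u w, G.Adj u w → u < w → u = p₁ w ∨ u = p₂ w) →
      ∀ B₀ B₁ B₂ B₃ : Set (Fin n), (∀ x ∈ B₀, x.val < m) → (∀ x ∈ B₁, x.val < m) → (∀ x ∈ B₂, x.val < m) →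
      (∀ x ∈ B₃, x.val < m) →
      (G.induce B₀).Connected → (G.induce B₁).Connected → (G.induce B₂).Connected → (G.induce B₃).Connected →
      Disjoint B₀ B₁ → Disjoint B₀ B₂ → Disjoint B₀ B₃ → Disjoint B₁ B₂ → Disjoint B₁ B₃ → Disjoint B₂ B₃ →
      (∃ u ∈ B₀, ∃ v ∈ B₁, G.Adj u v) → (∃ u ∈ B₀, ∃ v ∈ B₂, G.Adj u v) → (∃ u ∈ B₀, ∃ v ∈ B₃, G.Adj u v) →
      (∃ u ∈ B₁, ∃ v ∈ B₂, G.Adj u v) → (∃ u ∈ B₁, ∃ v ∈ B₃, G.Adj u v) → (∃ u ∈ B₂, ∃ v ∈ B₃, G.Adj u v) → False by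
    intro B₀ B₁ B₂ B₃
    exact key n H hH B₀ B₁ B₂ B₃ (fun x _ => x.isLt) (fun x _ => x.isLt) (fun x _ => x.isLt) (fun x _ => x.isLt)
  intro m
  induction m with
  | zero =>
    intro G _ B₀ B₁ B₂ B₃ hb0 _ _ _ c0
    intros
    obtain ⟨⟨x, hx⟩⟩ := c0.nonempty
    exact absurd (hb0 x hx) (Nat.not_lt_zero _)
  | succ m ih =>
    intro G hG B₀ B₁ B₂ B₃ hb0 hb1 hb2 hb3 c0 c1 c2 c3 d01 d02 d03 d12 d13 d23 a01 a02 a03 a12 a13 a23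
    by_cases hm : m < n
    swap
    · -- no vertex has value `m`: all bounds improve for free
      have hb : ∀ x : Fin n, x.val < m := fun x => lt_of_lt_of_le x.isLt (not_lt.mp hm)
      exact ih G hG B₀ B₁ B₂ B₃ (fun x _ => hb x) (fun x _ => hb x) (fun x _ => hb x) (fun x _ => hb x) c0 c1 c2 c3
        d01 d02 d03 d12 d13 d23 a01 a02 a03 a12 a13 a23
    set v : Fin n := ⟨m, hm⟩ with hvdef
    have hle : ∀ (B : Set (Fin n)), (∀ x ∈ B, x.val < m + 1) → ∀ x ∈ B, x ≤ v := fun B hB x hx => by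
      rw [Fin.le_def]; exact Nat.lt_succ_iff.mp (hB x hx)
    have hlt : ∀ (B : Set (Fin n)), (∀ x ∈ B, x < v) → ∀ x ∈ B, x.val < m := fun B hB x hx => by
      have h := hB x hx; rw [Fin.lt_def] at h; exact h
    have hlt' : ∀ (B : Set (Fin n)), (∀ x ∈ B, x.val < m + 1) → v ∉ B → ∀ x ∈ B, x.val < m := fun B hB hvB x hx => by
      have h1 := hB x hx
      have h2 : x.val ≠ m := fun h => hvB ((Fin.ext h : x = v) ▸ hx)
      omega
    have sy := fun {S T : Set (Fin n)} (h : ∃ u ∈ S, ∃ x ∈ T, G.Adj u x) =>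
      (show ∃ u ∈ T, ∃ x ∈ S, G.Adj u x from by obtain ⟨u, hu, x, hx, e⟩ := h; exact ⟨x, hx, u, hu, e.symm⟩)
    by_cases hv0 : v ∈ B₀
    · obtain ⟨G', B', hG', k0, k1, k2, k3, c0', c1', c2', c3', e01, e02, e03, e12, e13, e23, f01, f02, f03, f12, f13, f23⟩ :=
        Minor.twoTree_step p₁ p₂ hT G hG v hv0 (hle B₀ hb0) (hle B₁ hb1) (hle B₂ hb2) (hle B₃ hb3) c0 c1 c2 c3
          d01 d02 d03 d12 d13 d23 a01 a02 a03 a12 a13 a23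
      exact ih G' hG' B' B₁ B₂ B₃ (hlt _ k0) (hlt _ k1) (hlt _ k2) (hlt _ k3) c0' c1' c2' c3' e01 e02 e03 e12 e13 e23
        f01 f02 f03 f12 f13 f23
    by_cases hv1 : v ∈ B₁
    · -- reorder `(B₁, B₀, B₂, B₃)`
      obtain ⟨G', B', hG', k0, k1, k2, k3, c0', c1', c2', c3', e01, e02, e03, e12, e13, e23, f01, f02, f03, f12, f13, f23⟩ :=
        Minor.twoTree_step p₁ p₂ hT G hG v hv1 (hle B₁ hb1) (hle B₀ hb0) (hle B₂ hb2) (hle B₃ hb3) c1 c0 c2 c3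
          d01.symm d12 d13 d02 d03 d23 (sy a01) a12 a13 a02 a03 a23
      exact ih G' hG' B' B₀ B₂ B₃ (hlt _ k0) (hlt _ k1) (hlt _ k2) (hlt _ k3) c0' c1' c2' c3' e01 e02 e03 e12 e13 e23
        f01 f02 f03 f12 f13 f23
    by_cases hv2 : v ∈ B₂
    · -- reorder `(B₂, B₀, B₁, B₃)`
      obtain ⟨G', B', hG', k0, k1, k2, k3, c0', c1', c2', c3', e01, e02, e03, e12, e13, e23, f01, f02, f03, f12, f13, f23⟩ :=
        Minor.twoTree_step p₁ p₂ hT G hG v hv2 (hle B₂ hb2) (hle B₀ hb0) (hle B₁ hb1) (hle B₃ hb3) c2 c0 c1 c3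
          d02.symm d12.symm d23 d01 d03 d13 (sy a02) (sy a12) a23 a01 a03 a13
      exact ih G' hG' B' B₀ B₁ B₃ (hlt _ k0) (hlt _ k1) (hlt _ k2) (hlt _ k3) c0' c1' c2' c3' e01 e02 e03 e12 e13 e23
        f01 f02 f03 f12 f13 f23
    by_cases hv3 : v ∈ B₃
    · -- reorder `(B₃, B₀, B₁, B₂)`
      obtain ⟨G', B', hG', k0, k1, k2, k3, c0', c1', c2', c3', e01, e02, e03, e12, e13, e23, f01, f02, f03, f12, f13, f23⟩ :=
        Minor.twoTree_step p₁ p₂ hT G hG v hv3 (hle B₃ hb3) (hle B₀ hb0) (hle B₁ hb1) (hle B₂ hb2) c3 c0 c1 c2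
          d03.symm d13.symm d23.symm d01 d02 d12 (sy a03) (sy a13) (sy a23) a01 a02 a12
      exact ih G' hG' B' B₀ B₁ B₂ (hlt _ k0) (hlt _ k1) (hlt _ k2) (hlt _ k3) c0' c1' c2' c3' e01 e02 e03 e12 e13 e23
        f01 f02 f03 f12 f13 f23
    · exact ih G hG B₀ B₁ B₂ B₃ (hlt' B₀ hb0 hv0) (hlt' B₁ hb1 hv1) (hlt' B₂ hb2 hv2) (hlt' B₃ hb3 hv3) c0 c1 c2 c3
        d01 d02 d03 d12 d13 d23 a01 a02 a03 a12 a13 a23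

end TwoTree

end Consts

end Summit.CriticalPhenomena.PercolationContinuityZ3.Theorems
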